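import Summits.MatrixMultiplication.MatrixMultiplication.Theorems.SoloInformedCwTwoDemotion
import Summits.MatrixMultiplication.MatrixMultiplication.Theorems.SoloInformedCwTwoLevelOrient
import Summits.MatrixMultiplication.MatrixMultiplication.Theorems.SoloInformedCwTwoOnePairOrient

/-!
# CONJECTURE L by induction on the number of pairs: reduction to last-rigid systems (solo-informed, gen 13)

Lifting through the demotion lemma moves a working orientation of level `j'` of the demoted system to levels
`j'` and `j' + 1` of the full system (`uCount_snoc`).  With the oriented Theorem A (`onePair_orientedHallSix_T`,
level `0` works at `p = 1`) as the base, CONJECTURE L (`LevelConjecture`: every middle level `0 < j < p` contains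
a working orientation) for ALL mixed designs follows from the same statement for the designs whose last-pair
demotion is not a mixed design (`levelConjecture_of_rigidStep`).

Standard axioms only.
-/

namespace Summit.MatrixMultiplication.MatrixMultiplication.Theorems

open Finset

/-- The number of `U`'s after appending the orientation of the last pair. -/
theorem uCount_snoc {p : ℕ} (o : Fin p → Bool) (b : Bool) :
    uCount (Fin.snoc (α := fun _ => Bool) o b : Fin (p + 1) → Bool) = uCount o + (if b then 1 else 0) := by
  simp only [uCount, Finset.card_filter, Fin.sum_univ_castSucc, Fin.snoc_castSucc, Fin.snoc_last]

/-- The residual hypothesis: CONJECTURE L for the mixed designs whose last-pair demotion is not a mixed design. -/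
def LevelRigidStep : Prop :=
  ∀ {p q : ℕ} (s d : Fin (p + 1) → ℕ) (t : Fin q → ℕ), IsMixedDesign s d t →
    ¬ IsMixedDesign (fun i : Fin p => s i.castSucc) (fun i => d i.castSucc) (demoteT s d t) →
    ∀ j, 0 < j → j < p + 1 → ∃ o : Fin (p + 1) → Bool, uCount o = j ∧ OrientedHallSix s d t o

/-- **Reduction of CONJECTURE L to last-rigid systems.** -/
theorem levelConjecture_of_rigidStep (hstep : LevelRigidStep) : LevelConjecture := by
  intro p
  induction p with
  | zero =>
    intro q s d t hD j hj hjp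
    omega
  | succ p ih =>
    intro q s d t hD j hj hjp
    by_cases hdem : IsMixedDesign (fun i : Fin p => s i.castSucc) (fun i => d i.castSucc) (demoteT s d t)
    · rcases Nat.lt_or_ge j p with hlt | hge
      · -- lift a level-`j` orientation of the demoted system, last pair oriented `T`
        obtain ⟨o', hc, hw⟩ := ih _ _ _ hdem j hj hlt
        refine ⟨Fin.snoc (α := fun _ => Bool) o' false, ?_, orientedHallSix_of_demote s d t o' false hw⟩
        rw [uCount_snoc, hc]
        simp
      · have hjp' : j = p := by omega
        subst hjp'
        rcases Nat.lt_or_ge 1 j with h1 | h1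
        · -- `p ≥ 2`: lift a level-`(p-1)` orientation, last pair oriented `U`
          obtain ⟨o', hc, hw⟩ := ih _ _ _ hdem (j - 1) (by omega) (by omega)
          refine ⟨Fin.snoc (α := fun _ => Bool) o' true, ?_, orientedHallSix_of_demote s d t o' true hw⟩
          rw [uCount_snoc, hc]
          simp
          omega
        · -- `p = 1`: the demoted system has one pair; orientation `T` works there (oriented Theorem A)
          obtain rfl : j = 1 := by omega
          have hw := onePair_orientedHallSix_T _ _ _ hdem
          refine ⟨Fin.snoc (α := fun _ => Bool) (fun _ : Fin 1 => false) true, ?_,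
            orientedHallSix_of_demote s d t _ true hw⟩
          rw [uCount_snoc]
          simp [uCount]
    · exact hstep s d t hD hdem j hj hjp

end Summit.MatrixMultiplication.MatrixMultiplication.Theorems
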